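import Literature.Analysis.FluidPDE.AncientSimilarityVariables
import Literature.Analysis.FluidPDE.PineauVicolGaussSobolev
import Literature.Analysis.FluidPDE.PineauVicolWeightedIdentity
import Literature.Analysis.FluidPDE.PineauVicolEnstrophyIdentity
import Literature.Analysis.FluidPDE.VectorCalculus
import Summits.NavierStokesRegularity.NavierStokesRegularity.Theorems.RellichScarSymmetricScarExistsGaussianWindowLawLemmas

/-!
# Crux `SymmetricScarExists` (stmt-NavierStokesRegularity-11718), line `logtime-bernoulli-certificate`:
  STUB 2, the Gaussian window law (`stub_gaussianWindowLaw`)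

The registered stub `stub_gaussianWindowLaw`: for an eternal classical solution `(U, P)` of Leray's
backward system `∂ₛU + ½U + ½(y·∇)U + (U·∇)U + ∇P = ΔU`, `div U = 0` on `ℝ × ℝ³`
(`IsBackwardLeraySolutionOn univ 1 U P`) with the scale-invariant weighted bounds and the Gaussian
`g = e^{−|y|²/4}` (`PineauVicol2026.gaussWeight`), `E(s) = ∫ |U(s)|² g`: (i) `E(s) ≤ C² ∫ g`;
(ii) `½E(s₂) − ½E(s₁) = −∫_{s₁}^{s₂} (∫ |DU|²_F g + ½E + ½ ∫ (P + ½|U|²)(y·U) g)`.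
Continuing `…GaussianWindowLawLemmas` (Gaussian integrability, the viscous term): transport and
pressure against `g` (`L¹` divergence theorem, `div (g V) = −½ (y·V) g`), the slice identity
`∫ ⟨V, ∂ₛV⟩ g = −(∫ |DV|²_F g + ½ ∫ |V|² g + ½ ∫ (P + ½|V|²)(y·V) g)` (the drift cancels the weight
commutator of `Δ`), `E' = ∫ 2⟨U, ∂ₛU⟩ g` under the integral sign, continuity of the dissipation
functional (dominated convergence), and (ii) by the fundamental theorem of calculus.  Sources:
Giga–Kohn 1985 (weighted energy in similarity variables); Pineau–Vicol 2026, (4.1), (7.7).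
Folklore calculus, fully proved.  Lands `--supports stmt-NavierStokesRegularity-11718`.
-/
noncomputable section

open MeasureTheory Set Function Filter Topology InnerProductSpace
open scoped RealInnerProductSpace Laplacian ContDiff
open Literature.Analysis.FluidPDE Literature.Analysis.FluidPDE.PineauVicol2026

namespace Summit.NavierStokesRegularity.NavierStokesRegularity.Theorems.SymmetricScarExists.LogtimeBernoulli

section WindowLaw

variable {E : Type*} [NormedAddCommGroup E] [InnerProductSpace ℝ E] [FiniteDimensional ℝ E]
  [MeasurableSpace E] [BorelSpace E]

/-- **The transport term against the Gaussian weight.** For a divergence-free `V ∈ C¹` with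
`(1 + |y|)|V| ≤ A`, `|DV| ≤ B`: `∫ ⟨V, (V·∇)V⟩ g = ¼ ∫ |V|² (y·V) g`
(`⟨V, (V·∇)V⟩ = ½ V·∇|V|²`, the `L¹` divergence theorem, `div (g V) = −½ (y·V) g`). [folklore] -/
theorem integral_inner_convect_mul_gaussWeight {V : E → E} (hV : ContDiff ℝ 1 V)
    (hdiv : VectorCalculus.IsDivFree V) {A B : ℝ}
    (h0 : ∀ y, (1 + ‖y‖) * ‖V y‖ ≤ A) (h1 : ∀ y, ‖fderiv ℝ V y‖ ≤ B) :
    ∫ y, ⟪V y, fderiv ℝ V y (V y)⟫ * gaussWeight y =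
      (1 / 4 : ℝ) * ∫ y, ‖V y‖ ^ 2 * ⟪y, V y⟫ * gaussWeight y := by
  haveI : CompleteSpace E := FiniteDimensional.complete ℝ E
  have hA : ∀ y, ‖V y‖ ≤ A := fun y => le_of_one_add_norm_mul_le (norm_nonneg _) (h0 y)
  have hyA : ∀ y, ‖y‖ * ‖V y‖ ≤ A := fun y => norm_mul_le_of_one_add_norm_mul_le (norm_nonneg _) (h0 y)
  have hB0 : 0 ≤ B := (norm_nonneg _).trans (h1 0)
  have hg0 : ∀ y : E, 0 ≤ gaussWeight y := fun y => (gaussWeight_pos y).le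
  have cV : Continuous V := hV.continuous
  have cDV : Continuous (fderiv ℝ V) := hV.continuous_fderiv one_ne_zero
  have hθ : ContDiff ℝ 1 fun y => ‖V y‖ ^ 2 := hV.norm_sq ℝ
  have hu : ContDiff ℝ 1 fun y => gaussWeight y • V y := (contDiff_gaussWeight (n := 1)).smul hV
  -- the gradient of `|V|²` paired with `V`
  have hgrad : ∀ y, ⟪gaussWeight y • V y, gradient (fun z => ‖V z‖ ^ 2) y⟫ =
      2 * (⟪V y, fderiv ℝ V y (V y)⟫ * gaussWeight y) := by
    intro y
    rw [real_inner_smul_left, real_inner_comm, inner_gradient_left,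
      ((hV.differentiable one_ne_zero y).hasFDerivAt.norm_sq).fderiv, two_smul]
    simp only [add_apply, ContinuousLinearMap.comp_apply, innerSL_apply_apply]
    ring
  have hdivg : ∀ y, ‖V y‖ ^ 2 * VectorCalculus.divergence (fun z => gaussWeight z • V z) y =
      (-(1 / 2 : ℝ)) * (‖V y‖ ^ 2 * ⟪y, V y⟫ * gaussWeight y) := by
    intro y; rw [divergence_gaussWeight_smul hV hdiv y]; ring
  -- integrability
  have iF : Integrable fun y => ⟪V y, fderiv ℝ V y (V y)⟫ * gaussWeight y :=
    integrable_inner_mul_gaussWeight cV (cDV.clm_apply cV) hA fun y =>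
      (ContinuousLinearMap.le_opNorm _ _).trans (mul_le_mul (h1 y) (hA y) (norm_nonneg _) hB0)
  have iG : Integrable fun y => ‖V y‖ ^ 2 * ⟪y, V y⟫ * gaussWeight y :=
    integrable_mul_inner_id_mul_gaussWeight (cV.norm.pow 2) cV
      (fun y => by rw [abs_of_nonneg (sq_nonneg _)]; exact pow_le_pow_left₀ (norm_nonneg _) (hA y) 2)
      hyA
  have hint : Integrable fun y => ‖V y‖ ^ 2 • (gaussWeight y • V y) := by
    refine integrable_of_norm_le_const_mul_gaussWeight (M := A ^ 2 * A) ?_ ?_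
    · exact ((cV.norm.pow 2).smul (continuous_gaussWeight.smul cV)).aestronglyMeasurable
    · intro y
      have hgy := hg0 y
      rw [norm_smul, norm_smul, Real.norm_of_nonneg (sq_nonneg _), Real.norm_of_nonneg (hg0 y)]
      calc ‖V y‖ ^ 2 * (gaussWeight y * ‖V y‖) ≤ A ^ 2 * (gaussWeight y * A) :=
            mul_le_mul (pow_le_pow_left₀ (norm_nonneg _) (hA y) 2)
              (mul_le_mul_of_nonneg_left (hA y) hgy) (by positivity) (by positivity)
        _ = A ^ 2 * A * gaussWeight y := by ring
  have h₁ : Integrable fun y => ‖V y‖ ^ 2 * VectorCalculus.divergence (fun z => gaussWeight z • V z) y := by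
    simp_rw [hdivg]; exact iG.const_mul _
  have h₂ : Integrable fun y => ⟪gaussWeight y • V y, gradient (fun z => ‖V z‖ ^ 2) y⟫ := by
    simp_rw [hgrad]; exact iF.const_mul _
  have key := integral_mul_divergence_add_eq_zero_of_integrable hθ hu hint h₁ h₂
  simp_rw [hdivg, hgrad] at key
  rw [integral_const_mul, integral_const_mul] at key
  linarith

/-- **The pressure term against the Gaussian weight.** For a divergence-free `V ∈ C¹` with
`(1 + |y|)|V| ≤ A` and `Q ∈ C¹` with `|Q| ≤ B`, `|∇Q| ≤ B`: `∫ ⟨V, ∇Q⟩ g = ½ ∫ Q (y·V) g`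
(the `L¹` divergence theorem with `div (g V) = −½ (y·V) g`). [folklore] -/
theorem integral_inner_gradient_mul_gaussWeight {V : E → E} {Q : E → ℝ} (hV : ContDiff ℝ 1 V)
    (hQ : ContDiff ℝ 1 Q) (hdiv : VectorCalculus.IsDivFree V) {A B : ℝ}
    (h0 : ∀ y, (1 + ‖y‖) * ‖V y‖ ≤ A) (hQb : ∀ y, |Q y| ≤ B) (hQg : ∀ y, ‖gradient Q y‖ ≤ B) :
    ∫ y, ⟪V y, gradient Q y⟫ * gaussWeight y =
      (1 / 2 : ℝ) * ∫ y, Q y * ⟪y, V y⟫ * gaussWeight y := by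
  haveI : CompleteSpace E := FiniteDimensional.complete ℝ E
  have hA : ∀ y, ‖V y‖ ≤ A := fun y => le_of_one_add_norm_mul_le (norm_nonneg _) (h0 y)
  have hyA : ∀ y, ‖y‖ * ‖V y‖ ≤ A := fun y => norm_mul_le_of_one_add_norm_mul_le (norm_nonneg _) (h0 y)
  have hB0 : 0 ≤ B := (abs_nonneg _).trans (hQb 0)
  have hg0 : ∀ y : E, 0 ≤ gaussWeight y := fun y => (gaussWeight_pos y).le
  have cV : Continuous V := hV.continuous
  have cQ : Continuous Q := hQ.continuous
  have hu : ContDiff ℝ 1 fun y => gaussWeight y • V y := (contDiff_gaussWeight (n := 1)).smul hV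
  have hdivg : ∀ y, Q y * VectorCalculus.divergence (fun z => gaussWeight z • V z) y =
      (-(1 / 2 : ℝ)) * (Q y * ⟪y, V y⟫ * gaussWeight y) := by
    intro y; rw [divergence_gaussWeight_smul hV hdiv y]; ring
  have hgr : ∀ y, ⟪gaussWeight y • V y, gradient Q y⟫ = ⟪V y, gradient Q y⟫ * gaussWeight y := by
    intro y; rw [real_inner_smul_left, mul_comm]
  have iF : Integrable fun y => ⟪V y, gradient Q y⟫ * gaussWeight y :=
    integrable_inner_mul_gaussWeight cV (continuous_gradient_of_contDiff hQ) hA hQg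
  have iG : Integrable fun y => Q y * ⟪y, V y⟫ * gaussWeight y :=
    integrable_mul_inner_id_mul_gaussWeight cQ cV hQb hyA
  have hint : Integrable fun y => Q y • (gaussWeight y • V y) := by
    refine integrable_of_norm_le_const_mul_gaussWeight (M := B * A) ?_ ?_
    · exact (cQ.smul (continuous_gaussWeight.smul cV)).aestronglyMeasurable
    · intro y
      have hgy := hg0 y
      rw [norm_smul, norm_smul, Real.norm_of_nonneg (hg0 y), Real.norm_eq_abs]
      calc |Q y| * (gaussWeight y * ‖V y‖) ≤ B * (gaussWeight y * A) :=
            mul_le_mul (hQb y) (mul_le_mul_of_nonneg_left (hA y) hgy) (by positivity) hB0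
        _ = B * A * gaussWeight y := by ring
  have h₁ : Integrable fun y => Q y * VectorCalculus.divergence (fun z => gaussWeight z • V z) y := by
    simp_rw [hdivg]; exact iG.const_mul _
  have h₂ : Integrable fun y => ⟪gaussWeight y • V y, gradient Q y⟫ := by
    simp_rw [hgr]; exact iF
  have key := integral_mul_divergence_add_eq_zero_of_integrable hQ hu hint h₁ h₂
  simp_rw [hdivg, hgr] at key
  rw [integral_const_mul] at key
  linarith

/-- **Leray's momentum balance against `⟨V, ·⟩ g`.** For `V ∈ C²` divergence free with
`(1 + |y|)|V| ≤ A`, `|DV|, |D²V| ≤ B`, `Q ∈ C¹` with `|Q|, |∇Q| ≤ B`, and `T` with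
`T + ½V + ½(y·∇)V + (V·∇)V + ∇Q = ΔV` pointwise (Leray's backward momentum equation, `T = ∂ₛV`):
`∫ ⟨V, T⟩ g = −(∫ |DV|²_F g + ½ ∫ |V|² g + ½ ∫ (Q + ½|V|²)(y·V) g)` (the drift cancels the weight
commutator of `integral_inner_laplacian_mul_gaussWeight`; head pressure `Q + ½|V|²`). [folklore] -/
theorem integral_inner_leray_mul_gaussWeight {V T : E → E} {Q : E → ℝ} (hV : ContDiff ℝ 2 V)
    (hQ : ContDiff ℝ 1 Q) (hdiv : VectorCalculus.IsDivFree V) {A B : ℝ}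
    (h0 : ∀ y, (1 + ‖y‖) * ‖V y‖ ≤ A) (h1 : ∀ y, ‖fderiv ℝ V y‖ ≤ B)
    (h2 : ∀ y, ‖iteratedFDeriv ℝ 2 V y‖ ≤ B) (hQb : ∀ y, |Q y| ≤ B)
    (hQg : ∀ y, ‖gradient Q y‖ ≤ B)
    (heq : ∀ y, T y + (1 / 2 : ℝ) • V y + (1 / 2 : ℝ) • fderiv ℝ V y y + convect V V y +
      gradient Q y = (1 : ℝ) • (Δ V) y) :
    ∫ y, ⟪V y, T y⟫ * gaussWeight y =
      -((∫ y, frobeniusNormSq (fderiv ℝ V y) * gaussWeight y) +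
        (1 / 2 : ℝ) * (∫ y, ‖V y‖ ^ 2 * gaussWeight y) +
        (1 / 2 : ℝ) * ∫ y, (Q y + (1 / 2 : ℝ) * ‖V y‖ ^ 2) * ⟪y, V y⟫ * gaussWeight y) := by
  have hV1 : ContDiff ℝ 1 V := hV.of_le one_le_two
  have hA : ∀ y, ‖V y‖ ≤ A := fun y => le_of_one_add_norm_mul_le (norm_nonneg _) (h0 y)
  have hyA : ∀ y, ‖y‖ * ‖V y‖ ≤ A := fun y => norm_mul_le_of_one_add_norm_mul_le (norm_nonneg _) (h0 y)
  have hB0 : 0 ≤ B := (norm_nonneg _).trans (h1 0)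
  have cV : Continuous V := hV.continuous
  have cDV : Continuous (fderiv ℝ V) := hV.continuous_fderiv two_ne_zero
  -- pointwise expansion of `⟨V, T⟩ g`
  have hpt : ∀ y, ⟪V y, T y⟫ * gaussWeight y =
      ⟪V y, (Δ V) y⟫ * gaussWeight y - (1 / 2 : ℝ) * (‖V y‖ ^ 2 * gaussWeight y) -
        (1 / 2 : ℝ) * (⟪V y, fderiv ℝ V y y⟫ * gaussWeight y) -
        ⟪V y, fderiv ℝ V y (V y)⟫ * gaussWeight y - ⟪V y, gradient Q y⟫ * gaussWeight y := by
    intro y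
    have e : T y = (Δ V) y - (1 / 2 : ℝ) • V y - (1 / 2 : ℝ) • fderiv ℝ V y y - convect V V y -
        gradient Q y := by
      have h := heq y; rw [one_smul] at h
      rw [← h]; abel
    rw [e, convect_apply]
    simp only [inner_sub_right, inner_smul_right, real_inner_self_eq_norm_sq]
    ring
  -- integrability of the five terms
  have i1 : Integrable fun y => ⟪V y, (Δ V) y⟫ * gaussWeight y := by
    refine integrable_inner_mul_gaussWeight (B := Module.finrank ℝ E * B) cV
      (continuous_laplacian hV) hA fun y => ?_
    calc ‖(Δ V) y‖ ≤ Module.finrank ℝ E * ‖fderiv ℝ (fderiv ℝ V) y‖ := norm_laplacian_le V y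
      _ ≤ Module.finrank ℝ E * B := by
          refine mul_le_mul_of_nonneg_left ?_ (Nat.cast_nonneg _)
          rw [← norm_iteratedFDeriv_one (𝕜 := ℝ) (fderiv ℝ V), norm_iteratedFDeriv_fderiv]
          exact h2 y
  have i2 : Integrable fun y => ‖V y‖ ^ 2 * gaussWeight y := integrable_norm_sq_mul_gaussWeight' cV hA
  have i3 : Integrable fun y => ⟪V y, fderiv ℝ V y y⟫ * gaussWeight y :=
    integrable_inner_fderiv_apply_id_mul_gaussWeight hV1 hyA h1
  have i4 : Integrable fun y => ⟪V y, fderiv ℝ V y (V y)⟫ * gaussWeight y :=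
    integrable_inner_mul_gaussWeight cV (cDV.clm_apply cV) hA fun y =>
      (ContinuousLinearMap.le_opNorm _ _).trans (mul_le_mul (h1 y) (hA y) (norm_nonneg _) hB0)
  have i5 : Integrable fun y => ⟪V y, gradient Q y⟫ * gaussWeight y :=
    integrable_inner_mul_gaussWeight cV (continuous_gradient_of_contDiff hQ) hA hQg
  have i6 : Integrable fun y => Q y * ⟪y, V y⟫ * gaussWeight y :=
    integrable_mul_inner_id_mul_gaussWeight hQ.continuous cV hQb hyA
  have i7 : Integrable fun y => ‖V y‖ ^ 2 * ⟪y, V y⟫ * gaussWeight y :=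
    integrable_mul_inner_id_mul_gaussWeight (cV.norm.pow 2) cV
      (fun y => by rw [abs_of_nonneg (sq_nonneg _)]; exact pow_le_pow_left₀ (norm_nonneg _) (hA y) 2)
      hyA
  -- the three integrations by parts
  have hL := integral_inner_laplacian_mul_gaussWeight hV h0 h1 h2
  have hC := integral_inner_convect_mul_gaussWeight hV1 hdiv h0 h1
  have hP := integral_inner_gradient_mul_gaussWeight hV1 hQ hdiv h0 hQb hQg
  -- the head-pressure flux
  have hH : ∫ y, (Q y + (1 / 2 : ℝ) * ‖V y‖ ^ 2) * ⟪y, V y⟫ * gaussWeight y =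
      (∫ y, Q y * ⟪y, V y⟫ * gaussWeight y) +
        (1 / 2 : ℝ) * ∫ y, ‖V y‖ ^ 2 * ⟪y, V y⟫ * gaussWeight y := by
    rw [← integral_const_mul, ← integral_add i6 (i7.const_mul _)]
    exact integral_congr_ae (Eventually.of_forall fun y => by simp only; ring)
  -- assemble
  have j2 : Integrable fun y => ⟪V y, (Δ V) y⟫ * gaussWeight y -
      (1 / 2 : ℝ) * (‖V y‖ ^ 2 * gaussWeight y) := i1.sub (i2.const_mul _)
  have j3 : Integrable fun y => ⟪V y, (Δ V) y⟫ * gaussWeight y -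
      (1 / 2 : ℝ) * (‖V y‖ ^ 2 * gaussWeight y) -
      (1 / 2 : ℝ) * (⟪V y, fderiv ℝ V y y⟫ * gaussWeight y) := j2.sub (i3.const_mul _)
  have j4 : Integrable fun y => ⟪V y, (Δ V) y⟫ * gaussWeight y -
      (1 / 2 : ℝ) * (‖V y‖ ^ 2 * gaussWeight y) -
      (1 / 2 : ℝ) * (⟪V y, fderiv ℝ V y y⟫ * gaussWeight y) -
      ⟪V y, fderiv ℝ V y (V y)⟫ * gaussWeight y := j3.sub i4
  simp_rw [hpt]
  rw [integral_sub j4 i5, integral_sub j3 i4, integral_sub j2 (i3.const_mul _),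
    integral_sub i1 (i2.const_mul _), integral_const_mul, integral_const_mul, hL, hC, hP, hH]
  ring

/-! ### The Gaussian energy along an eternal smooth field: derivative, continuity, window law -/

/-- **Differentiating the Gaussian energy under the integral sign.** For `U` jointly smooth on
`ℝ × E` with `|U| ≤ C`, `|∂ₛU| ≤ K`, `s ↦ ∫ |U(s)|² g` has derivative `∫ 2⟨U(s), ∂ₛU(s)⟩ g`
(`hasDerivAt_integral_of_dominated_loc_of_deriv_le`, dominated by `2CK g`). [folklore] -/
theorem hasDerivAt_integral_norm_sq_mul_gaussWeight {U : ℝ → E → E}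
    (hU : IsSmoothSpaceTimeOn univ U) {C K : ℝ} (hC : ∀ s y, ‖U s y‖ ≤ C)
    (hK : ∀ s y, ‖deriv (fun σ => U σ y) s‖ ≤ K) (s : ℝ) :
    HasDerivAt (fun σ => ∫ y, ‖U σ y‖ ^ 2 * gaussWeight y)
      (∫ y, 2 * ⟪U s y, deriv (fun σ => U σ y) s⟫ * gaussWeight y) s := by
  have hC0 : 0 ≤ C := (norm_nonneg _).trans (hC s 0)
  have hUt : IsSmoothSpaceTimeOn univ fun t x => deriv (fun σ => U σ x) t :=
    hU.isSmoothSpaceTimeOn_deriv isOpen_univ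
  have key := hasDerivAt_integral_of_dominated_loc_of_deriv_le (μ := (volume : Measure E))
    (F := fun σ y => ‖U σ y‖ ^ 2 * gaussWeight y)
    (F' := fun σ y => 2 * ⟪U σ y, deriv (fun τ => U τ y) σ⟫ * gaussWeight y) (x₀ := s)
    (bound := fun y => 2 * (C * K) * gaussWeight y) (s := univ) univ_mem ?_ ?_ ?_ ?_ ?_ ?_
  · exact key.2
  · exact Eventually.of_forall fun σ => (((hU.contDiff_slice (mem_univ σ)).continuous.norm.pow
      2).mul continuous_gaussWeight).aestronglyMeasurable
  · exact integrable_norm_sq_mul_gaussWeight' (hU.contDiff_slice (mem_univ s)).continuous (hC s)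
  · exact ((continuous_const.mul ((hU.contDiff_slice (mem_univ s)).continuous.inner
      (hUt.contDiff_slice (mem_univ s)).continuous)).mul continuous_gaussWeight).aestronglyMeasurable
  · refine Eventually.of_forall fun y σ _ => ?_
    rw [norm_mul, norm_mul, Real.norm_of_nonneg (gaussWeight_pos y).le, Real.norm_of_nonneg zero_le_two]
    refine mul_le_mul_of_nonneg_right (mul_le_mul_of_nonneg_left ?_ zero_le_two)
      (gaussWeight_pos y).le
    exact (norm_inner_le_norm _ _).trans (mul_le_mul (hC σ y) (hK σ y) (norm_nonneg _) hC0)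
  · exact integrable_gaussWeight.const_mul _
  · exact Eventually.of_forall fun y σ _ =>
      ((hU.hasDerivAt_timeLine isOpen_univ (mem_univ σ) y).norm_sq).mul_const _

/-- **Continuity of the Gaussian dissipation** `s ↦ ∫ |DU(s)|²_F g` for `U` jointly smooth on
`ℝ × E` with `|DU| ≤ K` (dominated convergence, bound `dim E · K² g`). [folklore] -/
theorem continuous_integral_frobeniusNormSq_mul_gaussWeight {U : ℝ → E → E}
    (hU : IsSmoothSpaceTimeOn univ U) {K : ℝ} (hK : ∀ s y, ‖fderiv ℝ (U s) y‖ ≤ K) :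
    Continuous fun σ => ∫ y, frobeniusNormSq (fderiv ℝ (U σ) y) * gaussWeight y := by
  have hD : IsSmoothSpaceTimeOn univ fun t x => fderiv ℝ (U t) x :=
    hU.isSmoothSpaceTimeOn_fderiv_of_isOpen isOpen_univ
  refine continuous_of_dominated (bound := fun y => Module.finrank ℝ E * K ^ 2 * gaussWeight y) ?_ ?_ ?_ ?_
  · exact fun σ => ((continuous_frobeniusNormSq.comp (hD.contDiff_slice (mem_univ σ)).continuous).mul
      continuous_gaussWeight).aestronglyMeasurable
  · refine fun σ => Eventually.of_forall fun y => ?_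
    rw [norm_mul, Real.norm_of_nonneg (gaussWeight_pos y).le, Real.norm_of_nonneg (frobeniusNormSq_nonneg _)]
    refine mul_le_mul_of_nonneg_right ((frobeniusNormSq_le_finrank_mul _).trans ?_)
      (gaussWeight_pos y).le
    exact mul_le_mul_of_nonneg_left (pow_le_pow_left₀ (norm_nonneg _) (hK σ y) 2) (Nat.cast_nonneg _)
  · exact integrable_gaussWeight.const_mul _
  · exact Eventually.of_forall fun y =>
      (continuous_frobeniusNormSq.comp (continuous_timeLine hD y)).mul continuous_const

/-- **Continuity of the head-pressure flux** `s ↦ ∫ (P + ½|U|²)(y·U) g` for `U`, `P` jointly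
smooth on `ℝ × E`, `(1 + |y|)|U| ≤ C`, `|P| ≤ K` (dominated by `(K + ½C²) C g`). [folklore] -/
theorem continuous_integral_headFlux_mul_gaussWeight {U : ℝ → E → E} {P : ℝ → E → ℝ}
    (hU : IsSmoothSpaceTimeOn univ U) (hP : IsSmoothSpaceTimeOn univ P) {C K : ℝ}
    (h0 : ∀ s y, (1 + ‖y‖) * ‖U s y‖ ≤ C) (hPb : ∀ s y, |P s y| ≤ K) :
    Continuous fun σ =>
      ∫ y, (P σ y + (1 / 2 : ℝ) * ‖U σ y‖ ^ 2) * ⟪y, U σ y⟫ * gaussWeight y := by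
  have hA : ∀ s y, ‖U s y‖ ≤ C := fun s y => le_of_one_add_norm_mul_le (norm_nonneg _) (h0 s y)
  have hyA : ∀ s y, ‖y‖ * ‖U s y‖ ≤ C := fun s y => norm_mul_le_of_one_add_norm_mul_le (norm_nonneg _) (h0 s y)
  have hC0 : 0 ≤ C := (norm_nonneg _).trans (hA 0 0)
  have hK0 : 0 ≤ K := (abs_nonneg _).trans (hPb 0 0)
  have hb : ∀ s y, |P s y + (1 / 2 : ℝ) * ‖U s y‖ ^ 2| ≤ K + (1 / 2 : ℝ) * C ^ 2 := by
    intro s y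
    refine (abs_add_le _ _).trans (add_le_add (hPb s y) ?_)
    rw [abs_of_nonneg (by positivity)]
    exact mul_le_mul_of_nonneg_left (pow_le_pow_left₀ (norm_nonneg _) (hA s y) 2) (by norm_num)
  refine continuous_of_dominated (bound := fun y => (K + (1 / 2 : ℝ) * C ^ 2) * C * gaussWeight y) ?_ ?_ ?_ ?_
  · intro σ
    have cU : Continuous (U σ) := (hU.contDiff_slice (mem_univ σ)).continuous
    have cP : Continuous (P σ) := (hP.contDiff_slice (mem_univ σ)).continuous
    exact (((cP.add (continuous_const.mul (cU.norm.pow 2))).mul (continuous_id.inner cU)).mul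
      continuous_gaussWeight).aestronglyMeasurable
  · refine fun σ => Eventually.of_forall fun y => ?_
    rw [norm_mul, norm_mul, Real.norm_of_nonneg (gaussWeight_pos y).le, Real.norm_eq_abs, Real.norm_eq_abs]
    refine mul_le_mul_of_nonneg_right (mul_le_mul (hb σ y)
      ((abs_real_inner_le_norm _ _).trans (hyA σ y)) (abs_nonneg _) (by positivity))
      (gaussWeight_pos y).le
  · exact integrable_gaussWeight.const_mul _
  · refine Eventually.of_forall fun y => ?_
    have cU : Continuous fun s => U s y := continuous_timeLine hU y
    have cP : Continuous fun s => P s y := continuous_timeLine hP y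
    exact (((cP.add (continuous_const.mul (cU.norm.pow 2))).mul (continuous_const.inner cU)).mul
      continuous_const)

/-- **The Gaussian window law for an eternal smooth backward-Leray profile**: for a classical
solution of `∂ₛU + ½U + ½(y·∇)U + (U·∇)U + ∇P = ΔU`, `div U = 0` on `ℝ × E` with
`(1 + |y|)|U| ≤ C`, `|DU|, |D²U|, |P|, |∇P|, |∂ₛU| ≤ K`, and `E(s) = ∫ |U(s)|² g`,
`½E(s₂) − ½E(s₁) = −∫_{s₁}^{s₂} (∫ |DU|²_F g + ½ E + ½ ∫ (P + ½|U|²)(y·U) g)` (`E' = ∫ 2⟨U, ∂ₛU⟩ g`,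
the slice identity, continuity of the derivative, FTC; Giga–Kohn 1985). [folklore] -/
theorem gaussianWindowLaw_identity {U : ℝ → E → E} {P : ℝ → E → ℝ}
    (hsol : IsBackwardLeraySolutionOn univ 1 U P) {C K : ℝ}
    (h0 : ∀ s y, (1 + ‖y‖) * ‖U s y‖ ≤ C) (h1 : ∀ s y, ‖fderiv ℝ (U s) y‖ ≤ K)
    (h2 : ∀ s y, ‖iteratedFDeriv ℝ 2 (U s) y‖ ≤ K) (hPb : ∀ s y, |P s y| ≤ K)
    (hPg : ∀ s y, ‖gradient (P s) y‖ ≤ K) (hT : ∀ s y, ‖deriv (fun σ => U σ y) s‖ ≤ K)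
    (s₁ s₂ : ℝ) :
    (1 / 2 : ℝ) * (∫ y, ‖U s₂ y‖ ^ 2 * gaussWeight y) -
        (1 / 2 : ℝ) * (∫ y, ‖U s₁ y‖ ^ 2 * gaussWeight y) =
      -(∫ σ in s₁..s₂, ((∫ y, frobeniusNormSq (fderiv ℝ (U σ) y) * gaussWeight y) +
        (1 / 2 : ℝ) * (∫ y, ‖U σ y‖ ^ 2 * gaussWeight y) +
        (1 / 2 : ℝ) * (∫ y, (P σ y + (1 / 2 : ℝ) * ‖U σ y‖ ^ 2) * ⟪y, U σ y⟫ * gaussWeight y))) := by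
  have hUs : IsSmoothSpaceTimeOn univ U := hsol.smooth_velocity
  have hPs : IsSmoothSpaceTimeOn univ P := hsol.smooth_pressure
  have hA : ∀ s y, ‖U s y‖ ≤ C := fun s y => le_of_one_add_norm_mul_le (norm_nonneg _) (h0 s y)
  have hE := hasDerivAt_integral_norm_sq_mul_gaussWeight hUs hA hT
  -- the slice identity at every time
  have hslice : ∀ σ, ∫ y, 2 * ⟪U σ y, deriv (fun τ => U τ y) σ⟫ * gaussWeight y =
      2 * -((∫ y, frobeniusNormSq (fderiv ℝ (U σ) y) * gaussWeight y) +
        (1 / 2 : ℝ) * (∫ y, ‖U σ y‖ ^ 2 * gaussWeight y) +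
        (1 / 2 : ℝ) * ∫ y, (P σ y + (1 / 2 : ℝ) * ‖U σ y‖ ^ 2) * ⟪y, U σ y⟫ * gaussWeight y) := by
    intro σ
    have hV : ContDiff ℝ 2 (U σ) := (hsol.contDiff_velocity (mem_univ σ)).of_le (by norm_cast)
    have hQ : ContDiff ℝ 1 (P σ) := (hsol.contDiff_pressure (mem_univ σ)).of_le (by norm_cast)
    have heq : ∀ y, deriv (fun τ => U τ y) σ + (1 / 2 : ℝ) • U σ y +
        (1 / 2 : ℝ) • fderiv ℝ (U σ) y y + convect (U σ) (U σ) y + gradient (P σ) y =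
        (1 : ℝ) • (Δ (U σ)) y := by
      intro y
      have hm := hsol.momentum_leray (mem_univ σ) y
      rwa [timeDerivWithin_apply, derivWithin_univ] at hm
    rw [← integral_inner_leray_mul_gaussWeight hV hQ (hsol.divFree σ (mem_univ σ)) (h0 σ) (h1 σ)
      (h2 σ) (hPb σ) (hPg σ) heq, ← integral_const_mul]
    exact integral_congr_ae (Eventually.of_forall fun y => by simp only; ring)
  -- continuity of the dissipation functional
  have hcont : Continuous fun σ => (∫ y, frobeniusNormSq (fderiv ℝ (U σ) y) * gaussWeight y) +
      (1 / 2 : ℝ) * (∫ y, ‖U σ y‖ ^ 2 * gaussWeight y) +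
      (1 / 2 : ℝ) * ∫ y, (P σ y + (1 / 2 : ℝ) * ‖U σ y‖ ^ 2) * ⟪y, U σ y⟫ * gaussWeight y :=
    ((continuous_integral_frobeniusNormSq_mul_gaussWeight hUs h1).add (continuous_const.mul
      (continuous_iff_continuousAt.2 fun σ => (hE σ).continuousAt))).add
      (continuous_const.mul (continuous_integral_headFlux_mul_gaussWeight hUs hPs h0 hPb))
  -- the fundamental theorem of calculus for `½ E`
  have hderiv : ∀ σ ∈ uIcc s₁ s₂, HasDerivAt (fun σ => (1 / 2 : ℝ) * ∫ y, ‖U σ y‖ ^ 2 * gaussWeight y)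
      (-((∫ y, frobeniusNormSq (fderiv ℝ (U σ) y) * gaussWeight y) +
        (1 / 2 : ℝ) * (∫ y, ‖U σ y‖ ^ 2 * gaussWeight y) +
        (1 / 2 : ℝ) * ∫ y, (P σ y + (1 / 2 : ℝ) * ‖U σ y‖ ^ 2) * ⟪y, U σ y⟫ * gaussWeight y)) σ := by
    intro σ _
    refine ((hE σ).const_mul (1 / 2 : ℝ)).congr_deriv ?_
    rw [hslice σ]
    ring
  have hftc := intervalIntegral.integral_eq_sub_of_hasDerivAt hderiv (hcont.neg.intervalIntegrable _ _)
  rw [intervalIntegral.integral_neg] at hftc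
  exact hftc.symm

end WindowLaw

/-- **STUB 2 of line `logtime-bernoulli-certificate`: the Gaussian window law.** For an eternal
classical solution `(U, P)` of the backward Leray system `∂ₛU + ½U + ½(y·∇)U + (U·∇)U + ∇P = ΔU`,
`div U = 0` on `ℝ × ℝ³` (`IsBackwardLeraySolutionOn univ 1 U P`) with the scale-invariant weighted
bounds (`(1 + |y|)|U| ≤ C`, `(1 + |y|)²|DU| ≤ K`, …) and `g = e^{−|y|²/4}`, `E(s) = ∫ |U(s)|² g`:
(i) `E(s) ≤ C² ∫ g` (`|U| ≤ C`); (ii) the window law `gaussianWindowLaw_identity`.  Sources: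
Giga–Kohn 1985 (weighted energy in similarity variables); Pineau–Vicol 2026, (4.1), (7.7). [folklore] -/
theorem stub_gaussianWindowLaw :
    ∀ (C K : ℝ) (U : ℝ → EuclideanSpace ℝ (Fin 3) → EuclideanSpace ℝ (Fin 3)) (P : ℝ → EuclideanSpace ℝ (Fin 3) → ℝ), (Literature.Analysis.FluidPDE.IsBackwardLeraySolutionOn (Set.univ : Set ℝ) 1 U P ∧ ∀ (s : ℝ) (y : EuclideanSpace ℝ (Fin 3)), (1 + ‖y‖) * ‖U s y‖ ≤ C ∧ (1 + ‖y‖) ^ 2 * ‖fderiv ℝ (U s) y‖ ≤ K ∧ (1 + ‖y‖) ^ 3 * ‖iteratedFDeriv ℝ 2 (U s) y‖ ≤ K ∧ (1 + ‖y‖) ^ 2 * |P s y| ≤ K ∧ (1 + ‖y‖) ^ 3 * ‖gradient (P s) y‖ ≤ K ∧ (1 + ‖y‖) * ‖Literature.Analysis.FluidPDE.timeDerivWithin (Set.univ : Set ℝ) U s y‖ ≤ K ∧ (1 + ‖y‖) ^ 2 * ‖fderiv ℝ (fun z => Literature.Analysis.FluidPDE.timeDerivWithin (Set.univ : Set ℝ)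 U s z) y‖ ≤ K ∧ (1 + ‖y‖) ^ 3 * ‖Literature.Analysis.FluidPDE.timeDerivWithin (Set.univ : Set ℝ) U s y + (1 / 2 : ℝ) • U s y + (1 / 2 : ℝ) • fderiv ℝ (U s) y y‖ ≤ K) → ((∀ s : ℝ, (∫ y : EuclideanSpace ℝ (Fin 3), ‖U s y‖ ^ 2 * Literature.Analysis.FluidPDE.PineauVicol2026.gaussWeight y) ≤ C ^ 2 * (∫ y : EuclideanSpace ℝ (Fin 3), Literature.Analysis.FluidPDE.PineauVicol2026.gaussWeight y)) ∧ ∀ s₁ s₂ : ℝ, s₁ ≤ s₂ → (1 / 2 : ℝ) * (∫ y : EuclideanSpace ℝ (Fin 3), ‖U s₂ y‖ ^ 2 * Literature.Analysis.FluidPDE.PineauVicol2026.gaussWeight y) - (1 / 2 : ℝ) * (∫ y : EuclideanSpace ℝ (Fin 3), ‖U s₁ y‖ ^ 2 * Literature.Analysis.FluidPDE.PineauVicol2026.gaussWeight y) = -(∫ σ in s₁..s₂, ((∫ y : EuclideanSpace ℝ (Fin 3), Literature.Analysis.FluidPDE.frobeniusNormSq (fderiv ℝ (U σ) y) * Literature.Analysis.FluidPDE.PineauVicol2026.gaussWeight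 y) + (1 / 2 : ℝ) * (∫ y : EuclideanSpace ℝ (Fin 3), ‖U σ y‖ ^ 2 * Literature.Analysis.FluidPDE.PineauVicol2026.gaussWeight y) + (1 / 2 : ℝ) * (∫ y : EuclideanSpace ℝ (Fin 3), (P σ y + (1 / 2 : ℝ) * ‖U σ y‖ ^ 2) * inner ℝ y (U σ y) * Literature.Analysis.FluidPDE.PineauVicol2026.gaussWeight y)))) := by
  intro C K U P h
  obtain ⟨hsol, hb⟩ := h
  have h0 : ∀ s y, (1 + ‖y‖) * ‖U s y‖ ≤ C := fun s y => (hb s y).1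
  have hA : ∀ s y, ‖U s y‖ ≤ C := fun s y => le_of_one_add_norm_mul_le (norm_nonneg _) (h0 s y)
  have h1 : ∀ s y, ‖fderiv ℝ (U s) y‖ ≤ K := fun s y => le_of_one_add_norm_pow_mul_le (norm_nonneg _) (hb s y).2.1
  have h2 : ∀ s y, ‖iteratedFDeriv ℝ 2 (U s) y‖ ≤ K := fun s y =>
    le_of_one_add_norm_pow_mul_le (norm_nonneg _) (hb s y).2.2.1
  have hPb : ∀ s y, |P s y| ≤ K := fun s y => le_of_one_add_norm_pow_mul_le (abs_nonneg _) (hb s y).2.2.2.1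
  have hPg : ∀ s y, ‖gradient (P s) y‖ ≤ K := fun s y =>
    le_of_one_add_norm_pow_mul_le (norm_nonneg _) (hb s y).2.2.2.2.1
  have hT : ∀ s y, ‖deriv (fun σ => U σ y) s‖ ≤ K := fun s y => by
    have h := le_of_one_add_norm_mul_le (norm_nonneg _) (hb s y).2.2.2.2.2.1
    rwa [timeDerivWithin_apply, derivWithin_univ] at h
  refine ⟨fun s => ?_, fun s₁ s₂ _ => gaussianWindowLaw_identity hsol h0 h1 h2 hPb hPg hT s₁ s₂⟩
  have hle : ∀ y : EuclideanSpace ℝ (Fin 3), ‖U s y‖ ^ 2 * gaussWeight y ≤ C ^ 2 * gaussWeight y :=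
    fun y => mul_le_mul_of_nonneg_right (pow_le_pow_left₀ (norm_nonneg _) (hA s y) 2)
      (gaussWeight_pos y).le
  calc ∫ y, ‖U s y‖ ^ 2 * gaussWeight y ≤ ∫ y, C ^ 2 * gaussWeight y :=
        integral_mono_of_nonneg (Eventually.of_forall fun y => mul_nonneg (sq_nonneg _)
          (gaussWeight_pos y).le) (integrable_gaussWeight.const_mul _) (Eventually.of_forall hle)
    _ = C ^ 2 * ∫ y, gaussWeight y := integral_const_mul _ _

end Summit.NavierStokesRegularity.NavierStokesRegularity.Theorems.SymmetricScarExists.LogtimeBernoulli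

end
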